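import Mathlib
import Summits.NavierStokesRegularity.NavierStokesRegularity.Theorems.WakeRatchetTailRatchetRelayNonlinearMap
import Summits.NavierStokesRegularity.NavierStokesRegularity.Theorems.WakeRatchetTailRatchetRelayInverseBound
import HarnessLib

/-!
# `WakeRatchet.TailRatchet` (stmt-NavierStokesRegularity-21808): the CONTRACTION STEP of the lacunary
# front construction — one Picard step is a self-map of the weighted ball and halves distances

Support file for the crux `TailRatchet` (route `WakeRatchet`; MODEL lattice ODEs of Tao 2016 §1.2, §4 —
nothing in this file is a statement about the Navier–Stokes equations, and no item is closed here).

Context (programme "R-lac" of the census of stmt-21808, ASSEMBLY).  At a fixed time ratio `s ∈ [3/2, 2]`,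
`η = |s − 2|`, the scalar front equation of `DyadicScalarFronts` for `b = e^{t} + h` at drain parameter
`δ = Λ^{-2}` reads `b' = (4/s²) b(t/s)² − 4sδ·b(t)b(st)`, equivalently (`…RelayNonlinearMap.front_iff_bordered`)
`h' = 2e^{t/2}h(t/2) + (N_s(h,δ) − δ·8e^{3t})` with the nonlinear forcing `N_s`.  The Picard map
`(h, δ) ↦ (g, ε) := M⁻¹ N_s(h, δ)` (`M⁻¹` = the drain-bordered inverse of `…RelayInverseBound`) is studied on
the weighted ball `|h|, |h'| ≤ r e^{t/2}` (`t ≤ 0`), `|δ| ≤ r`: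

* `weighted_bound_Iic` — a weighted bound on `t < 0` extends to `t ≤ 0` by continuity;
* `picard_step` — ONE STEP: for `(h, h', δ)` in the ball of radius `r` the image `(g, g', ε)` exists and lies in
  the ball of radius `K·A(r)`, `A(r) = 4η + 22ηr + 20r² + 16r³`, `K = 1100000`;
* `picard_contract` — CONTRACTION: two ball states at weighted distance `μ` have images at weighted distance
  `≤ K(22η + 36r + 32r²)·μ`.

With `r = 8Kη` and `η ≤ 10⁻²⁶` the step maps the ball to itself and contracts by `≤ 1/2`; the fixed point
(the lacunary front) is extracted in the companion file `…RelayFixedPoint`.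

HONEST FRAMING: bookkeeping of explicit constants over the tree's linear theory; MODEL lattice only; lacunary
fronts (large `Λ`, i.e. LARGE `ε₀`) do NOT refute `TailRatchet` (which needs `Λ → 1`); the construction item
and the crux stay open.
-/

noncomputable section

set_option linter.dupNamespace false

namespace Summit.NavierStokesRegularity.NavierStokesRegularity.Theorems

namespace WakeRatchetRelayContraction

open Set Filter Topology MeasureTheory
open WakeRatchetRelayNonlinearMap WakeRatchetRelayInverseBound

/-! ## Extension of weighted bounds to the closed half-line -/

/-- A weighted bound `|φ| ≤ A e^{t/2}` valid on `t < 0` extends to `t ≤ 0` when `φ` is continuous. [folklore] -/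
theorem weighted_bound_Iic {φ : ℝ → ℝ} {A : ℝ} (hφ : Continuous φ)
    (h : ∀ t : ℝ, t < 0 → |φ t| ≤ A * Real.exp (t / 2)) :
    ∀ t : ℝ, t ≤ 0 → |φ t| ≤ A * Real.exp (t / 2) := by
  intro t ht
  have hC : IsClosed {t : ℝ | |φ t| ≤ A * Real.exp (t / 2)} :=
    isClosed_le (continuous_abs.comp hφ) (by fun_prop)
  have hsub : Iio (0 : ℝ) ⊆ {t : ℝ | |φ t| ≤ A * Real.exp (t / 2)} := fun t ht => h t ht
  have hcl := closure_minimal hsub hC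
  rw [closure_Iio] at hcl
  exact hcl ht

/-! ## One Picard step -/

/-- **ONE PICARD STEP.**  For `3/2 ≤ s ≤ 2` and a state `(h, h', δ)` with `h` continuous, `h' =` the
derivative of `h` on `t < 0`, `|h(t)| ≤ r e^{t/2}` (`t ≤ 0`), `|h'(t)| ≤ r e^{t/2}` (`t < 0`), `|δ| ≤ r`, the
drain-bordered inverse applied to the forcing `N_s(h, δ)` yields `(g, ε)` — `g` continuous, `g(0) = 0`,
`g → 0` at `−∞`, `g' = 2e^{t/2}g(t/2) + (N_s(h,δ) − ε·8e^{3t})` on `t < 0` — with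
`|ε|, |g|e^{-t/2}, |g'|e^{-t/2} ≤ K·A(r)`, `A(r) = 4|s−2| + 22|s−2|r + 20r² + 16r³`, `K = 1100000`.
[cite: Tao2016AveragedNS, §1.2 (dyadic model); cell vocabulary (programme R-lac of the census of stmt-21808, assembly)] -/
theorem picard_step {s r : ℝ} (hs1 : 3 / 2 ≤ s) (hs2 : s ≤ 2) {h h' : ℝ → ℝ} {δ : ℝ}
    (hc : Continuous h) (hd : ∀ t : ℝ, t < 0 → HasDerivAt h (h' t) t)
    (hρ : ∀ t : ℝ, t ≤ 0 → |h t| ≤ r * Real.exp (t / 2))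
    (hD : ∀ t : ℝ, t < 0 → |h' t| ≤ r * Real.exp (t / 2)) (hδ : |δ| ≤ r) :
    ∃ ε : ℝ, ∃ g : ℝ → ℝ, Continuous g ∧ g 0 = 0 ∧ Tendsto g atBot (𝓝 0) ∧
      (∀ t : ℝ, t < 0 → HasDerivAt g
        (2 * Real.exp (t / 2) * g (t / 2) +
          (((-(Real.exp t - 4 / s ^ 2 * Real.exp (2 * t / s)) -
              (2 * Real.exp (t / 2) * h (t / 2) - 8 / s ^ 2 * Real.exp (t / s) * h (t / s)) +
              4 / s ^ 2 * h (t / s) ^ 2 -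
              δ * (4 * s * ((Real.exp t + h t) * (Real.exp (s * t) + h (s * t))) - 8 * Real.exp (3 * t))))
            - ε * (8 * Real.exp (3 * t)))) t) ∧
      |ε| ≤ 1100000 * (4 * |s - 2| + 22 * |s - 2| * r + 20 * r ^ 2 + 16 * r ^ 3) ∧
      (∀ t : ℝ, t ≤ 0 → |g t| ≤
        1100000 * (4 * |s - 2| + 22 * |s - 2| * r + 20 * r ^ 2 + 16 * r ^ 3) * Real.exp (t / 2)) ∧
      (∀ t : ℝ, t ≤ 0 → |2 * Real.exp (t / 2) * g (t / 2) +
          (((-(Real.exp t - 4 / s ^ 2 * Real.exp (2 * t / s)) -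
              (2 * Real.exp (t / 2) * h (t / 2) - 8 / s ^ 2 * Real.exp (t / s) * h (t / s)) +
              4 / s ^ 2 * h (t / s) ^ 2 -
              δ * (4 * s * ((Real.exp t + h t) * (Real.exp (s * t) + h (s * t))) - 8 * Real.exp (3 * t))))
            - ε * (8 * Real.exp (3 * t)))| ≤
        1100000 * (4 * |s - 2| + 22 * |s - 2| * r + 20 * r ^ 2 + 16 * r ^ 3) * Real.exp (t / 2)) := by
  -- the forcing and its weighted bound
  set N : ℝ → ℝ := fun t =>
    (-(Real.exp t - 4 / s ^ 2 * Real.exp (2 * t / s)) -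
      (2 * Real.exp (t / 2) * h (t / 2) - 8 / s ^ 2 * Real.exp (t / s) * h (t / s)) +
      4 / s ^ 2 * h (t / s) ^ 2 -
      δ * (4 * s * ((Real.exp t + h t) * (Real.exp (s * t) + h (s * t))) - 8 * Real.exp (3 * t))) with hN
  set A : ℝ := 4 * |s - 2| + |s - 2| * (9 * r + 7 * r) + 4 * r ^ 2 + r * (16 * (1 + r) * r + 6 * |s - 2|)
    with hA
  have hAeq : A = 4 * |s - 2| + 22 * |s - 2| * r + 20 * r ^ 2 + 16 * r ^ 3 := by rw [hA]; ring
  have hr0 : 0 ≤ r := (abs_nonneg _).trans hδ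
  have hA0 : 0 ≤ A := by rw [hA]; positivity
  have hNlt : ∀ t : ℝ, t < 0 → |N t| ≤ A * Real.exp (t / 2) := fun t ht => by
    have := forcing_bound hs1 hs2 (δ₀ := r) hd hρ hD hδ ht
    simpa only [hN, hA] using this
  have hNc : Continuous N := by
    rw [hN]
    fun_prop
  have hNle : ∀ t : ℝ, t ≤ 0 → |N t| ≤ A * Real.exp (t / 2) := weighted_bound_Iic hNc hNlt
  obtain ⟨ε, g, hgc, hg0, hgl, hgd, hε, hgb, hgb'⟩ := drain_bordered_inverse_bound hNc hNle
  refine ⟨ε, g, hgc, hg0, hgl, ?_, ?_, ?_, ?_⟩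
  · intro t ht
    have := hgd t ht
    simpa only [hN] using this
  · rw [← hAeq]; linarith
  · intro t ht
    rw [← hAeq]
    exact (hgb t ht).trans (by nlinarith [Real.exp_pos (t / 2)])
  · intro t ht
    rw [← hAeq]
    have := hgb' t ht
    simp only [hN] at this ⊢
    exact this.trans (le_of_eq (by ring))

/-! ## Contraction -/

/-- **CONTRACTION OF THE PICARD STEP.**  For `3/2 ≤ s ≤ 2` let `(h₁, h₁', δ₁)`, `(h₂, h₂', δ₂)` be two states
in the weighted ball of radius `r` (as in `picard_step`) at weighted distance `μ`
(`|h₁−h₂|, |h₁'−h₂'| ≤ μe^{t/2}`, `|δ₁−δ₂| ≤ μ`), and let `(g₁, ε₁)`, `(g₂, ε₂)` be bounded normalised decaying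
solutions of the drain-bordered problems with forcings `N_s(h₁,δ₁)`, `N_s(h₂,δ₂)`.  Then the images are at
weighted distance `≤ K(22|s−2| + 36r + 32r²)·μ`, `K = 1100000`.
[cite: Tao2016AveragedNS, §1.2 (dyadic model); cell vocabulary (programme R-lac of the census of stmt-21808, assembly)] -/
theorem picard_contract {s r μ : ℝ} (hs1 : 3 / 2 ≤ s) (hs2 : s ≤ 2)
    {h₁ h₁' h₂ h₂' g₁ g₂ : ℝ → ℝ} {δ₁ δ₂ ε₁ ε₂ B₁ B₂ : ℝ}
    (hc₁ : Continuous h₁) (hc₂ : Continuous h₂)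
    (hd₁ : ∀ t : ℝ, t < 0 → HasDerivAt h₁ (h₁' t) t) (hd₂ : ∀ t : ℝ, t < 0 → HasDerivAt h₂ (h₂' t) t)
    (hρ₁ : ∀ t : ℝ, t ≤ 0 → |h₁ t| ≤ r * Real.exp (t / 2))
    (hρ₂ : ∀ t : ℝ, t ≤ 0 → |h₂ t| ≤ r * Real.exp (t / 2))
    (hδ₁ : |δ₁| ≤ r)
    (hgc₁ : Continuous g₁) (hgc₂ : Continuous g₂) (hg0₁ : g₁ 0 = 0) (hg0₂ : g₂ 0 = 0)
    (hgl₁ : Tendsto g₁ atBot (𝓝 0)) (hgl₂ : Tendsto g₂ atBot (𝓝 0))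
    (hgB₁ : ∀ t : ℝ, t ≤ 0 → |g₁ t| ≤ B₁) (hgB₂ : ∀ t : ℝ, t ≤ 0 → |g₂ t| ≤ B₂)
    (hgd₁ : ∀ t : ℝ, t < 0 → HasDerivAt g₁
        (2 * Real.exp (t / 2) * g₁ (t / 2) +
          (((-(Real.exp t - 4 / s ^ 2 * Real.exp (2 * t / s)) -
              (2 * Real.exp (t / 2) * h₁ (t / 2) - 8 / s ^ 2 * Real.exp (t / s) * h₁ (t / s)) +
              4 / s ^ 2 * h₁ (t / s) ^ 2 -
              δ₁ * (4 * s * ((Real.exp t + h₁ t) * (Real.exp (s * t) + h₁ (s * t))) - 8 * Real.exp (3 * t))))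
            - ε₁ * (8 * Real.exp (3 * t)))) t)
    (hgd₂ : ∀ t : ℝ, t < 0 → HasDerivAt g₂
        (2 * Real.exp (t / 2) * g₂ (t / 2) +
          (((-(Real.exp t - 4 / s ^ 2 * Real.exp (2 * t / s)) -
              (2 * Real.exp (t / 2) * h₂ (t / 2) - 8 / s ^ 2 * Real.exp (t / s) * h₂ (t / s)) +
              4 / s ^ 2 * h₂ (t / s) ^ 2 -
              δ₂ * (4 * s * ((Real.exp t + h₂ t) * (Real.exp (s * t) + h₂ (s * t))) - 8 * Real.exp (3 * t))))
            - ε₂ * (8 * Real.exp (3 * t)))) t)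
    (hμ : ∀ t : ℝ, t ≤ 0 → |h₁ t - h₂ t| ≤ μ * Real.exp (t / 2))
    (hμ' : ∀ t : ℝ, t < 0 → |h₁' t - h₂' t| ≤ μ * Real.exp (t / 2))
    (hμδ : |δ₁ - δ₂| ≤ μ) :
    |ε₁ - ε₂| ≤ 1100000 * (22 * |s - 2| + 36 * r + 32 * r ^ 2) * μ ∧
      (∀ t : ℝ, t ≤ 0 → |g₁ t - g₂ t| ≤
        1100000 * (22 * |s - 2| + 36 * r + 32 * r ^ 2) * μ * Real.exp (t / 2)) ∧
      (∀ t : ℝ, t ≤ 0 →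
        |(2 * Real.exp (t / 2) * g₁ (t / 2) +
          (((-(Real.exp t - 4 / s ^ 2 * Real.exp (2 * t / s)) -
              (2 * Real.exp (t / 2) * h₁ (t / 2) - 8 / s ^ 2 * Real.exp (t / s) * h₁ (t / s)) +
              4 / s ^ 2 * h₁ (t / s) ^ 2 -
              δ₁ * (4 * s * ((Real.exp t + h₁ t) * (Real.exp (s * t) + h₁ (s * t))) - 8 * Real.exp (3 * t))))
            - ε₁ * (8 * Real.exp (3 * t)))) -
         (2 * Real.exp (t / 2) * g₂ (t / 2) +
          (((-(Real.exp t - 4 / s ^ 2 * Real.exp (2 * t / s)) -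
              (2 * Real.exp (t / 2) * h₂ (t / 2) - 8 / s ^ 2 * Real.exp (t / s) * h₂ (t / s)) +
              4 / s ^ 2 * h₂ (t / s) ^ 2 -
              δ₂ * (4 * s * ((Real.exp t + h₂ t) * (Real.exp (s * t) + h₂ (s * t))) - 8 * Real.exp (3 * t))))
            - ε₂ * (8 * Real.exp (3 * t))))| ≤
        1100000 * (22 * |s - 2| + 36 * r + 32 * r ^ 2) * μ * Real.exp (t / 2)) := by
  -- the two forcings
  set N₁ : ℝ → ℝ := fun t =>
    (-(Real.exp t - 4 / s ^ 2 * Real.exp (2 * t / s)) -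
      (2 * Real.exp (t / 2) * h₁ (t / 2) - 8 / s ^ 2 * Real.exp (t / s) * h₁ (t / s)) +
      4 / s ^ 2 * h₁ (t / s) ^ 2 -
      δ₁ * (4 * s * ((Real.exp t + h₁ t) * (Real.exp (s * t) + h₁ (s * t))) - 8 * Real.exp (3 * t))) with hN₁
  set N₂ : ℝ → ℝ := fun t =>
    (-(Real.exp t - 4 / s ^ 2 * Real.exp (2 * t / s)) -
      (2 * Real.exp (t / 2) * h₂ (t / 2) - 8 / s ^ 2 * Real.exp (t / s) * h₂ (t / s)) +
      4 / s ^ 2 * h₂ (t / s) ^ 2 -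
      δ₂ * (4 * s * ((Real.exp t + h₂ t) * (Real.exp (s * t) + h₂ (s * t))) - 8 * Real.exp (3 * t))) with hN₂
  have hr0 : 0 ≤ r := (abs_nonneg _).trans hδ₁
  have hμ0 : 0 ≤ μ := (abs_nonneg _).trans hμδ
  -- Lipschitz bound of the forcing on `t < 0`
  set A₁₂ : ℝ := (22 * |s - 2| + 36 * r + 32 * r ^ 2) * μ with hA₁₂
  have hdiff : ∀ ξ : ℝ, ξ < 0 → HasDerivAt (fun x => h₁ x - h₂ x) (h₁' ξ - h₂' ξ) ξ :=
    fun ξ hξ => (hd₁ ξ hξ).sub (hd₂ ξ hξ)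
  have hNlt : ∀ t : ℝ, t < 0 → |N₁ t - N₂ t| ≤ A₁₂ * Real.exp (t / 2) := by
    intro t ht
    have hL := forcing_lipschitz hs1 hs2 (δ₀ := r) hρ₁ hρ₂ hdiff hμ hμ' hδ₁ (δ₂ := δ₂) ht
    have hcoef : (|s - 2| * (9 * μ + 7 * μ) + 4 * r * μ + r * (16 * (1 + r) * μ) +
        |δ₁ - δ₂| * (16 * (1 + r) * r + 6 * |s - 2|)) ≤ A₁₂ := by
      have h1 : |δ₁ - δ₂| * (16 * (1 + r) * r + 6 * |s - 2|) ≤ μ * (16 * (1 + r) * r + 6 * |s - 2|) :=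
        mul_le_mul_of_nonneg_right hμδ (by positivity)
      rw [hA₁₂]; nlinarith [abs_nonneg (s - 2)]
    have := hL.trans (mul_le_mul_of_nonneg_right hcoef (Real.exp_pos _).le)
    simpa only [hN₁, hN₂] using this
  have hNc : Continuous (fun t => N₁ t - N₂ t) := by rw [hN₁, hN₂]; fun_prop
  have hNle : ∀ t : ℝ, t ≤ 0 → |N₁ t - N₂ t| ≤ A₁₂ * Real.exp (t / 2) := weighted_bound_Iic hNc hNlt
  -- the bordered problems
  have hgd₁' : ∀ t : ℝ, t < 0 → HasDerivAt g₁
      (2 * Real.exp (t / 2) * g₁ (t / 2) + (N₁ t - ε₁ * (8 * Real.exp (3 * t)))) t := fun t ht => by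
    simpa only [hN₁] using hgd₁ t ht
  have hgd₂' : ∀ t : ℝ, t < 0 → HasDerivAt g₂
      (2 * Real.exp (t / 2) * g₂ (t / 2) + (N₂ t - ε₂ * (8 * Real.exp (3 * t)))) t := fun t ht => by
    simpa only [hN₂] using hgd₂ t ht
  have hN₁c : Continuous N₁ := by rw [hN₁]; fun_prop
  have hN₂c : Continuous N₂ := by rw [hN₂]; fun_prop
  obtain ⟨hε, hg, hg'⟩ := drain_bordered_difference hN₁c hN₂c hNle hgc₁.continuousOn hgc₂.continuousOn
    hgd₁' hgd₂' hgB₁ hgB₂ hg0₁ hg0₂ hgl₁ hgl₂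
  have hK : 474 * A₁₂ ≤ 1100000 * (22 * |s - 2| + 36 * r + 32 * r ^ 2) * μ := by
    rw [hA₁₂]; nlinarith [abs_nonneg (s - 2)]
  have hK' : 510000 * A₁₂ ≤ 1100000 * (22 * |s - 2| + 36 * r + 32 * r ^ 2) * μ := by
    rw [hA₁₂]; nlinarith [abs_nonneg (s - 2)]
  have hK'' : 1100000 * A₁₂ = 1100000 * (22 * |s - 2| + 36 * r + 32 * r ^ 2) * μ := by
    rw [hA₁₂]; ring
  refine ⟨hε.trans hK, fun t ht => (hg t ht).trans (mul_le_mul_of_nonneg_right hK' (Real.exp_pos _).le),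
    fun t ht => ?_⟩
  have := hg' t ht
  rw [hK''] at this
  refine le_trans (le_of_eq ?_) this
  congr 1
  simp only [hN₁, hN₂]
  ring

end WakeRatchetRelayContraction

end Summit.NavierStokesRegularity.NavierStokesRegularity.Theorems

end
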